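import Summits.CriticalPhenomena.PercolationContinuityZ3.Theorems.PercNearOneGluingNoHeavyLowerTailSwitchRelaxCubic
import HarnessLib

/-!
# `NoHeavyLowerTail` (stmt-CriticalPhenomena-4575) — the finite relaxation of switching certificates, III c:
# SPECTATOR SLICING — the QUARTIC identity of a sliced four-copy certificate, checked reflectively

Support file (prover prim-masterthm-p1 gen 3; `--supports stmt-CriticalPhenomena-4575`).  No named facts, no sorries.

A ONE-SPECTATOR four-copy switching certificate (prim-masterthm-p1, SCHEMA-K §10: copies `X` explored, `Y`, `Z` active, `W` a
spectator that is never touched) for a quartic Sahi row `E₄(A, B, C, D) ≥ 0` is, after SLICING by the spectator's type `q`, a family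
of fifteen THREE-copy certificates `c_q : SwitchRelax.Cert` (each checkable by parts II/IId–IIe, giving `E[S_q] = ES c_q P ≤ 0`)
together with ONE polynomial identity in the 15 type masses `P`:
`Σ_q P_q · (Σ λ₀^q(r,s,t) P_r P_s P_t) + σ · Σ_q P_q · (Σ_p Σ λ_p^q(s,t) P_s P_t) + D · E₄ʰᵒᵐ(P) ≡ 0`   (`σ = Σ P`).
Here the identity is checked by the KERNEL on integer tables, exactly as part III b (`…SwitchRelaxCubic`) does for cubics:
`quarticCheckAt` symmetrises the coefficient function over the 24 orderings of `(q,r,s,t)` (as `symC` of part III b in the last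
three slots, over the four choices of the first slot) and tests the SORTED index quadruples with a given smallest entry (fifteen
kernel pieces); a bubble-sort lemma (`sort4_spec`, by `decide`) transports vanishing from sorted to all quadruples.
`quartic_sound` turns the fifteen pieces, the table hypotheses, `Σ P = 1`, `0 ≤ P` and `ES c_q P ≤ 0 (q : Ty)` into the cell-level
`E₄ ≥ 0`:  `0 ≤ 6·S(ABCD) − 2·Σ S(ABC)S(D) − Σ S(AB)S(CD) + Σ S(AB)S(C)S(D) − S(A)S(B)S(C)S(D)`  (`S(L) = Σ_{i∈L} P_i` over the cell
lists of the fifteen intersections), which the dictionary of a measure file turns into `0 ≤ sahiE4 …`.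
-/

namespace Summit.CriticalPhenomena.PercolationContinuityZ3.Theorems

namespace SwitchRelax

open Finset FourPointAtoms
open scoped BigOperators

/-! ### Cell lists of a quartic row and the coefficient function of `E₄ʰᵒᵐ` -/

/-- The fifteen cell lists of a quartic row: the four events and all their intersections. [this work] -/
structure E4Lists where
  /-- cells of `A` -/ A : List ℕ
  /-- cells of `B` -/ B : List ℕ
  /-- cells of `C` -/ C : List ℕ
  /-- cells of `D` -/ D : List ℕ
  /-- cells of `A ∩ B` -/ AB : List ℕ
  /-- cells of `A ∩ C` -/ AC : List ℕ
  /-- cells of `A ∩ D` -/ AD : List ℕ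
  /-- cells of `B ∩ C` -/ BC : List ℕ
  /-- cells of `B ∩ D` -/ BD : List ℕ
  /-- cells of `C ∩ D` -/ CD : List ℕ
  /-- cells of `A ∩ B ∩ C` -/ ABC : List ℕ
  /-- cells of `A ∩ B ∩ D` -/ ABD : List ℕ
  /-- cells of `A ∩ C ∩ D` -/ ACD : List ℕ
  /-- cells of `B ∩ C ∩ D` -/ BCD : List ℕ
  /-- cells of `A ∩ B ∩ C ∩ D` -/ ABCD : List ℕ

/-- All fifteen cell lists admissible (indices `< 15`, no repetitions). [this work] -/
def E4Lists.ok (E : E4Lists) : Bool :=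
  listOK E.A && listOK E.B && listOK E.C && listOK E.D && listOK E.AB && listOK E.AC && listOK E.AD && listOK E.BC &&
  listOK E.BD && listOK E.CD && listOK E.ABC && listOK E.ABD && listOK E.ACD && listOK E.BCD && listOK E.ABCD

/-- Coefficient function of the homogenised `E₄` (slots `q`, `r`, `s`, `t`):
`6·m(ABCD)σ³ − 2·Σ m(ABC)m(D)σ² − Σ m(AB)m(CD)σ² + Σ m(AB)m(C)m(D)σ − m(A)m(B)m(C)m(D)`. [this work] -/
def e4C (E : E4Lists) (q r s t : Ty) : ℤ :=
  6 * ind E.ABCD q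
  - 2 * (ind E.ABC q * ind E.D r + ind E.ABD q * ind E.C r + ind E.ACD q * ind E.B r + ind E.BCD q * ind E.A r)
  - (ind E.AB q * ind E.CD r + ind E.AC q * ind E.BD r + ind E.AD q * ind E.BC r)
  + (ind E.AB q * ind E.C r * ind E.D s + ind E.AC q * ind E.B r * ind E.D s + ind E.AD q * ind E.B r * ind E.C s
    + ind E.BC q * ind E.A r * ind E.D s + ind E.BD q * ind E.A r * ind E.C s + ind E.CD q * ind E.A r * ind E.B s)
  - ind E.A q * ind E.B r * ind E.C s * ind E.D t

/-- The cell-level `E₄` of a quartic row (`σ = 1` form). [this work] -/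
noncomputable def E4cell (E : E4Lists) (P : Ty → ℝ) : ℝ :=
  6 * S E.ABCD P - 2 * (S E.ABC P * S E.D P + S E.ABD P * S E.C P + S E.ACD P * S E.B P + S E.BCD P * S E.A P)
  - (S E.AB P * S E.CD P + S E.AC P * S E.BD P + S E.AD P * S E.BC P)
  + (S E.AB P * S E.C P * S E.D P + S E.AC P * S E.B P * S E.D P + S E.AD P * S E.B P * S E.C P
    + S E.BC P * S E.A P * S E.D P + S E.BD P * S E.A P * S E.C P + S E.CD P * S E.A P * S E.B P)
  - S E.A P * S E.B P * S E.C P * S E.D P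

/-! ### Symmetrisation over the 24 orderings and the sliced coefficient function -/

/-- Symmetrisation of a four-slot coefficient function over the 24 orderings (`symC` over the last three slots, for each
choice of the first). [folklore] -/
def symC4 (F : Ty → Ty → Ty → Ty → ℤ) (q r s t : Ty) : ℤ :=
  symC (F q) r s t + symC (F r) q s t + symC (F s) q r t + symC (F t) q r s

/-- The coefficient function of the sliced identity, from the tables: `λ₀^q(r,s,t) + Σ_p λ_p^q(s,t) + D·e4C`, where
`T0s[q]` is the tabulated `λ₀` of slice `q` and `TPs[q]` the list of its tabulated program potentials. [this work] -/
def coefZ4 (T0s TPs : List (List (List (List ℤ)))) (D : ℤ) (E : E4Lists) (q r s t : Ty) : ℤ :=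
  get2 (getN (getN T0s q.val []) r.val []) s.val t.val + lpC (getN TPs q.val []) s t + D * e4C E q r s t

/-- **THE QUARTIC CHECK, piece `q₀`**: all symmetrised coefficients vanish at the sorted quadruples `q₀ ≤ r ≤ s ≤ t`. [this work] -/
def quarticCheckAt (T0s TPs : List (List (List (List ℤ)))) (D : ℤ) (E : E4Lists) (q₀ : Ty) : Bool :=
  allTys.all fun r => allTys.all fun s => allTys.all fun t =>
    !(decide (q₀ ≤ r) && decide (r ≤ s) && decide (s ≤ t)) || (symC4 (coefZ4 T0s TPs D E) q₀ r s t == 0)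

/-- **THE QUARTIC CHECK, scalar part**: `D > 0` and admissible cell lists. [this work] -/
def quarticCheck0 (D : ℤ) (E : E4Lists) : Bool := decide (0 < D) && E.ok

/-! ### Sorting four indices (to pass from sorted quadruples to all quadruples) -/

/-- Compare–exchange of two types. [folklore] -/
def cs (a b : Ty) : Ty × Ty := if a ≤ b then (a, b) else (b, a)

/-- Bubble-sorting network on four entries (adjacent compare–exchanges (12)(23)(34)(12)(23)(12)). [folklore] -/
def sort4 (q r s t : Ty) : Ty × Ty × Ty × Ty :=
  let a := cs q r
  let b := cs a.2 s
  let c := cs b.2 t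
  let d := cs a.1 b.1
  let e := cs d.2 c.1
  let f := cs d.1 e.1
  (f.1, f.2, e.2, c.2)

/-- The network sorts (kernel check over all `15⁴` inputs). [folklore] -/
theorem sort4_spec : ∀ q r s t : Ty, ((sort4 q r s t).1 ≤ (sort4 q r s t).2.1 ∧ (sort4 q r s t).2.1 ≤ (sort4 q r s t).2.2.1 ∧
    (sort4 q r s t).2.2.1 ≤ (sort4 q r s t).2.2.2) := by
  decide +kernel

/-- A function invariant under the transposition (12) is invariant under the first compare–exchange. [folklore] -/
theorem cs12_inv (G : Ty → Ty → Ty → Ty → ℤ) (h12 : ∀ q r s t, G q r s t = G r q s t) (q r s t : Ty) :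
    G q r s t = G (cs q r).1 (cs q r).2 s t := by
  unfold cs; split_ifs <;> simp [h12 q r s t]

/-- … under (23) and the middle compare–exchange. [folklore] -/
theorem cs23_inv (G : Ty → Ty → Ty → Ty → ℤ) (h23 : ∀ q r s t, G q r s t = G q s r t) (q r s t : Ty) :
    G q r s t = G q (cs r s).1 (cs r s).2 t := by
  unfold cs; split_ifs <;> simp [h23 q r s t]

/-- … under (34) and the last compare–exchange. [folklore] -/
theorem cs34_inv (G : Ty → Ty → Ty → Ty → ℤ) (h34 : ∀ q r s t, G q r s t = G q r t s) (q r s t : Ty) :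
    G q r s t = G q r (cs s t).1 (cs s t).2 := by
  unfold cs; split_ifs <;> simp [h34 q r s t]

/-- … hence a function invariant under the adjacent transpositions is invariant under the whole sorting network. [folklore] -/
theorem sort4_inv (G : Ty → Ty → Ty → Ty → ℤ) (h12 : ∀ q r s t, G q r s t = G r q s t) (h23 : ∀ q r s t, G q r s t = G q s r t)
    (h34 : ∀ q r s t, G q r s t = G q r t s) (q r s t : Ty) :
    G q r s t = G (sort4 q r s t).1 (sort4 q r s t).2.1 (sort4 q r s t).2.2.1 (sort4 q r s t).2.2.2 := by
  have e1 := cs12_inv G h12 q r s t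
  have e2 := cs23_inv G h23 (cs q r).1 (cs q r).2 s t
  have e3 := cs34_inv G h34 (cs q r).1 (cs (cs q r).2 s).1 (cs (cs q r).2 s).2 t
  have e4 := cs12_inv G h12 (cs q r).1 (cs (cs q r).2 s).1 (cs (cs (cs q r).2 s).2 t).1 (cs (cs (cs q r).2 s).2 t).2
  have e5 := cs23_inv G h23 (cs (cs q r).1 (cs (cs q r).2 s).1).1 (cs (cs q r).1 (cs (cs q r).2 s).1).2
    (cs (cs (cs q r).2 s).2 t).1 (cs (cs (cs q r).2 s).2 t).2
  have e6 := cs12_inv G h12 (cs (cs q r).1 (cs (cs q r).2 s).1).1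
    (cs (cs (cs q r).1 (cs (cs q r).2 s).1).2 (cs (cs (cs q r).2 s).2 t).1).1
    (cs (cs (cs q r).1 (cs (cs q r).2 s).1).2 (cs (cs (cs q r).2 s).2 t).1).2 (cs (cs (cs q r).2 s).2 t).2
  simp only [sort4]
  rw [e1, e2, e3, e4, e5, e6]

/-- **Vanishing on sorted quadruples implies vanishing everywhere** (for a symmetric function). [folklore] -/
theorem zero_of_sorted (G : Ty → Ty → Ty → Ty → ℤ) (h12 : ∀ q r s t, G q r s t = G r q s t)
    (h23 : ∀ q r s t, G q r s t = G q s r t) (h34 : ∀ q r s t, G q r s t = G q r t s)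
    (hs : ∀ q r s t : Ty, q ≤ r → r ≤ s → s ≤ t → G q r s t = 0) (q r s t : Ty) : G q r s t = 0 := by
  rw [sort4_inv G h12 h23 h34 q r s t]
  obtain ⟨h1, h2, h3⟩ := sort4_spec q r s t
  exact hs _ _ _ _ h1 h2 h3

/-- `symC4 F` is invariant under swapping the first two slots. [folklore] -/
theorem symC4_swap12 (F : Ty → Ty → Ty → Ty → ℤ) (q r s t : Ty) : symC4 F q r s t = symC4 F r q s t := by
  simp only [symC4, symC]; ring

/-- `symC4 F` is invariant under swapping the middle slots. [folklore] -/
theorem symC4_swap23 (F : Ty → Ty → Ty → Ty → ℤ) (q r s t : Ty) : symC4 F q r s t = symC4 F q s r t := by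
  simp only [symC4, symC]; ring

/-- `symC4 F` is invariant under swapping the last two slots. [folklore] -/
theorem symC4_swap34 (F : Ty → Ty → Ty → Ty → ℤ) (q r s t : Ty) : symC4 F q r s t = symC4 F q r t s := by
  simp only [symC4, symC]; ring

/-- From the fifteen kernel pieces: the symmetrised coefficient function vanishes identically. [this work] -/
theorem symC4_eq_zero_of_checkAt {T0s TPs : List (List (List (List ℤ)))} {D : ℤ} {E : E4Lists}
    (h : ∀ q₀ : Ty, quarticCheckAt T0s TPs D E q₀ = true) (q r s t : Ty) : symC4 (coefZ4 T0s TPs D E) q r s t = 0 := by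
  refine zero_of_sorted _ (symC4_swap12 _) (symC4_swap23 _) (symC4_swap34 _) ?_ q r s t
  intro q r s t hqr hrs hst
  have hq := h q
  simp only [quarticCheckAt, List.all_eq_true] at hq
  have := hq r (mem_allTys r) s (mem_allTys s) t (mem_allTys t)
  simp only [hqr, hrs, hst, decide_true, Bool.and_self, Bool.not_true, Bool.false_or, beq_iff_eq] at this
  exact this

/-! ### Quartic forms -/

section Forms

variable (P : Ty → ℝ)

/-- The quartic form of a real coefficient function. [this work] -/
noncomputable def form4 (F : Ty → Ty → Ty → Ty → ℝ) : ℝ := ∑ q, ∑ r, ∑ s, ∑ t, F q r s t * (P q * P r * P s * P t)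

/-- Additivity. [folklore] -/
theorem form4_add (F G : Ty → Ty → Ty → Ty → ℝ) : form4 P (fun q r s t => F q r s t + G q r s t) = form4 P F + form4 P G := by
  simp only [form4, add_mul, Finset.sum_add_distrib]

/-- Subtraction. [folklore] -/
theorem form4_sub (F G : Ty → Ty → Ty → Ty → ℝ) : form4 P (fun q r s t => F q r s t - G q r s t) = form4 P F - form4 P G := by
  simp only [form4, sub_mul, Finset.sum_sub_distrib]

/-- Scalars. [folklore] -/
theorem form4_smul (a : ℝ) (F : Ty → Ty → Ty → Ty → ℝ) : form4 P (fun q r s t => a * F q r s t) = a * form4 P F := by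
  simp only [form4, mul_assoc, Finset.mul_sum]

/-- Swapping slots 1 and 2. [folklore] -/
theorem form4_swap12 (F : Ty → Ty → Ty → Ty → ℝ) : form4 P (fun q r s t => F r q s t) = form4 P F := by
  unfold form4
  rw [Finset.sum_comm]
  exact Finset.sum_congr rfl fun q _ => Finset.sum_congr rfl fun r _ => Finset.sum_congr rfl fun s _ =>
    Finset.sum_congr rfl fun t _ => by ring

/-- Swapping slots 2 and 3. [folklore] -/
theorem form4_swap23 (F : Ty → Ty → Ty → Ty → ℝ) : form4 P (fun q r s t => F q s r t) = form4 P F := by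
  unfold form4
  refine Finset.sum_congr rfl fun q _ => ?_
  rw [Finset.sum_comm]
  exact Finset.sum_congr rfl fun r _ => Finset.sum_congr rfl fun s _ => Finset.sum_congr rfl fun t _ => by ring

/-- Swapping slots 3 and 4. [folklore] -/
theorem form4_swap34 (F : Ty → Ty → Ty → Ty → ℝ) : form4 P (fun q r s t => F q r t s) = form4 P F := by
  unfold form4
  refine Finset.sum_congr rfl fun q _ => Finset.sum_congr rfl fun r _ => ?_
  rw [Finset.sum_comm]
  exact Finset.sum_congr rfl fun s _ => Finset.sum_congr rfl fun t _ => by ring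

/-- The inner symmetrisation multiplies the form by 6. [this work] -/
theorem form4_symC (F : Ty → Ty → Ty → Ty → ℝ) :
    form4 P (fun q r s t => F q r s t + F q r t s + F q s r t + F q s t r + F q t r s + F q t s r) = 6 * form4 P F := by
  have h2 : form4 P (fun q r s t => F q r t s) = form4 P F := form4_swap34 P F
  have h3 : form4 P (fun q r s t => F q s r t) = form4 P F := form4_swap23 P F
  have h4 : form4 P (fun q r s t => F q s t r) = form4 P F :=
    (form4_swap23 P (fun q r s t => F q r t s)).trans h2
  have h5 : form4 P (fun q r s t => F q t r s) = form4 P F :=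
    (form4_swap34 P (fun q r s t => F q s r t)).trans h3
  have h6 : form4 P (fun q r s t => F q t s r) = form4 P F :=
    (form4_swap34 P (fun q r s t => F q s t r)).trans h4
  rw [form4_add, form4_add, form4_add, form4_add, form4_add, h2, h3, h4, h5, h6]; ring

/-- **A coefficient function with vanishing 24-fold symmetrisation has vanishing quartic form.** [this work] -/
theorem form4_eq_zero_of_symC4 (F : Ty → Ty → Ty → Ty → ℤ) (h : ∀ q r s t, symC4 F q r s t = 0) :
    form4 P (fun q r s t => (F q r s t : ℝ)) = 0 := by
  set G : Ty → Ty → Ty → Ty → ℝ := fun q r s t => (F q r s t : ℝ) with hG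
  -- inner symmetrisations with the first slot taken by q, r, s, t respectively
  set H : Ty → Ty → Ty → Ty → ℝ := fun q r s t => G q r s t + G q r t s + G q s r t + G q s t r + G q t r s + G q t s r with hH
  have hH6 : form4 P H = 6 * form4 P G := form4_symC P G
  have hA : form4 P (fun q r s t => H r q s t) = form4 P H := form4_swap12 P H
  have hB : form4 P (fun q r s t => H s q r t) = form4 P H :=
    (form4_swap23 P (fun q r s t => H r q s t)).trans hA
  have hC : form4 P (fun q r s t => H t q r s) = form4 P H :=
    (form4_swap34 P (fun q r s t => H s q r t)).trans hB
  have hsum : form4 P (fun q r s t => H q r s t + H r q s t + H s q r t + H t q r s) = 24 * form4 P G := by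
    rw [form4_add, form4_add, form4_add, hA, hB, hC, hH6]; ring
  have h0 : form4 P (fun q r s t => H q r s t + H r q s t + H s q r t + H t q r s) = 0 := by
    unfold form4
    refine Finset.sum_eq_zero fun q _ => Finset.sum_eq_zero fun r _ => Finset.sum_eq_zero fun s _ =>
      Finset.sum_eq_zero fun t _ => ?_
    have h1 := h q r s t
    simp only [symC4, symC] at h1
    have h' : (F q r s t : ℝ) + F q r t s + F q s r t + F q s t r + F q t r s + F q t s r
        + (F r q s t + F r q t s + F r s q t + F r s t q + F r t q s + F r t s q)
        + (F s q r t + F s q t r + F s r q t + F s r t q + F s t q r + F s t r q)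
        + (F t q r s + F t q s r + F t r q s + F t r s q + F t s q r + F t s r q) = 0 := by exact_mod_cast h1
    simp only [hH, hG, h', zero_mul]
  have : 24 * form4 P G = 0 := hsum ▸ h0
  linarith

/-- Product coefficient functions factor. [folklore] -/
theorem form4_prod (u v w z : Ty → ℝ) : form4 P (fun q r s t => u q * v r * w s * z t) =
    (∑ q, u q * P q) * (∑ r, v r * P r) * (∑ s, w s * P s) * (∑ t, z t * P t) := by
  unfold form4
  symm
  rw [Finset.sum_mul, Finset.sum_mul, Finset.sum_mul]
  refine Finset.sum_congr rfl fun q _ => ?_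
  rw [show u q * P q * (∑ r, v r * P r) * (∑ s, w s * P s) * (∑ t, z t * P t) =
      u q * P q * ((∑ r, v r * P r) * (∑ s, w s * P s) * (∑ t, z t * P t)) by ring, ← form_prod P v w z, form,
    Finset.mul_sum]
  refine Finset.sum_congr rfl fun r _ => ?_
  rw [Finset.mul_sum]
  refine Finset.sum_congr rfl fun s _ => ?_
  rw [Finset.mul_sum]
  exact Finset.sum_congr rfl fun t _ => by ring

/-- A coefficient function depending on the first slot and the last two: `Σ_q P_q · (σ · quadratic_q)`. [folklore] -/
theorem form4_of134 (g : Ty → Ty → Ty → ℝ) :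
    form4 P (fun q _ s t => g q s t) = (∑ r, P r) * ∑ q, P q * ∑ s, ∑ t, g q s t * (P s * P t) := by
  unfold form4
  rw [Finset.mul_sum]
  refine Finset.sum_congr rfl fun q _ => ?_
  rw [Finset.sum_mul]
  refine Finset.sum_congr rfl fun r _ => ?_
  rw [← mul_assoc, Finset.mul_sum]
  refine Finset.sum_congr rfl fun s _ => ?_
  rw [Finset.mul_sum]
  exact Finset.sum_congr rfl fun t _ => by ring

/-- A coefficient function depending on all slots through `q` and a cubic: `Σ_q P_q · cubic_q`. [folklore] -/
theorem form4_of1 (g : Ty → Ty → Ty → Ty → ℝ) :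
    form4 P g = ∑ q, P q * ∑ r, ∑ s, ∑ t, g q r s t * (P r * P s * P t) := by
  unfold form4
  refine Finset.sum_congr rfl fun q _ => ?_
  rw [Finset.mul_sum]
  refine Finset.sum_congr rfl fun r _ => ?_
  rw [Finset.mul_sum]
  refine Finset.sum_congr rfl fun s _ => ?_
  rw [Finset.mul_sum]
  exact Finset.sum_congr rfl fun t _ => by ring

/-- `E4Lists.ok` unpacked into the fifteen `listOK`s. [this work] -/
theorem E4Lists.ok_iff (E : E4Lists) : E.ok = true ↔
    (listOK E.A = true ∧ listOK E.B = true ∧ listOK E.C = true ∧ listOK E.D = true ∧ listOK E.AB = true ∧ listOK E.AC = true ∧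
     listOK E.AD = true ∧ listOK E.BC = true ∧ listOK E.BD = true ∧ listOK E.CD = true ∧ listOK E.ABC = true ∧ listOK E.ABD = true ∧
     listOK E.ACD = true ∧ listOK E.BCD = true ∧ listOK E.ABCD = true) := by
  simp only [E4Lists.ok, Bool.and_eq_true]; tauto

/-- The indicator of an admissible list sums the masses (restated with `listOK`). [this work] -/
theorem sum_ind' {L : List ℕ} (h : listOK L = true) : ∑ r, (ind L r : ℝ) * P r = S L P :=
  sum_ind P L (listOK_iff.1 h).1 (listOK_iff.1 h).2

/-- The `E₄ʰᵒᵐ` part of the form, for admissible cell lists. [this work] -/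
theorem form4_e4C {E : E4Lists} (hE : E.ok = true) :
    form4 P (fun q r s t => (e4C E q r s t : ℝ)) =
      6 * S E.ABCD P * (∑ r, P r) * (∑ r, P r) * (∑ r, P r)
      - 2 * (S E.ABC P * S E.D P + S E.ABD P * S E.C P + S E.ACD P * S E.B P + S E.BCD P * S E.A P) * (∑ r, P r) * (∑ r, P r)
      - (S E.AB P * S E.CD P + S E.AC P * S E.BD P + S E.AD P * S E.BC P) * (∑ r, P r) * (∑ r, P r)
      + (S E.AB P * S E.C P * S E.D P + S E.AC P * S E.B P * S E.D P + S E.AD P * S E.B P * S E.C P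
        + S E.BC P * S E.A P * S E.D P + S E.BD P * S E.A P * S E.C P + S E.CD P * S E.A P * S E.B P) * (∑ r, P r)
      - S E.A P * S E.B P * S E.C P * S E.D P := by
  obtain ⟨hA, hB, hC, hD, hAB, hAC, hAD, hBC, hBD, hCD, hABC, hABD, hACD, hBCD, hABCD⟩ := (E4Lists.ok_iff E).1 hE
  have e : (fun q r s t => (e4C E q r s t : ℝ)) = fun q r s t =>
      (6 * (ind E.ABCD q : ℝ)) * 1 * 1 * 1
      - ((2 * (ind E.ABC q : ℝ)) * (ind E.D r : ℝ) * 1 * 1 + (2 * (ind E.ABD q : ℝ)) * (ind E.C r : ℝ) * 1 * 1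
          + (2 * (ind E.ACD q : ℝ)) * (ind E.B r : ℝ) * 1 * 1 + (2 * (ind E.BCD q : ℝ)) * (ind E.A r : ℝ) * 1 * 1)
      - ((ind E.AB q : ℝ) * (ind E.CD r : ℝ) * 1 * 1 + (ind E.AC q : ℝ) * (ind E.BD r : ℝ) * 1 * 1
          + (ind E.AD q : ℝ) * (ind E.BC r : ℝ) * 1 * 1)
      + ((ind E.AB q : ℝ) * (ind E.C r : ℝ) * (ind E.D s : ℝ) * 1 + (ind E.AC q : ℝ) * (ind E.B r : ℝ) * (ind E.D s : ℝ) * 1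
          + (ind E.AD q : ℝ) * (ind E.B r : ℝ) * (ind E.C s : ℝ) * 1 + (ind E.BC q : ℝ) * (ind E.A r : ℝ) * (ind E.D s : ℝ) * 1
          + (ind E.BD q : ℝ) * (ind E.A r : ℝ) * (ind E.C s : ℝ) * 1 + (ind E.CD q : ℝ) * (ind E.A r : ℝ) * (ind E.B s : ℝ) * 1)
      - (ind E.A q : ℝ) * (ind E.B r : ℝ) * (ind E.C s : ℝ) * (ind E.D t : ℝ) := by
    funext q r s t; simp only [e4C]; push_cast; ring
  have two : ∀ L : List ℕ, listOK L = true → ∑ q, 2 * (ind L q : ℝ) * P q = 2 * S L P := by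
    intro L hL; rw [← sum_ind' P hL, Finset.mul_sum]; exact Finset.sum_congr rfl fun q _ => by ring
  have six : ∑ q, 6 * (ind E.ABCD q : ℝ) * P q = 6 * S E.ABCD P := by
    rw [← sum_ind' P hABCD, Finset.mul_sum]; exact Finset.sum_congr rfl fun q _ => by ring
  rw [e, form4_sub, form4_add, form4_sub, form4_sub]
  simp only [form4_add, form4_prod]
  rw [six, two _ hABC, two _ hABD, two _ hACD, two _ hBCD, sum_ind' P hA, sum_ind' P hB, sum_ind' P hC, sum_ind' P hD,
    sum_ind' P hAB, sum_ind' P hAC, sum_ind' P hAD, sum_ind' P hBC, sum_ind' P hBD, sum_ind' P hCD, sum_one_mul]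
  ring

end Forms

/-! ### Soundness of the quartic check -/

/-- **From the quartic check (scalar part + fifteen pieces), the table hypotheses of the fifteen slices, `Σ P = 1`, `0 ≤ P`
and `ES c_q P ≤ 0` for every slice, to `E₄ ≥ 0` at the level of cells.** [this work] -/
theorem quartic_sound (c : Ty → Cert) {T0s TPs : List (List (List (List ℤ)))}
    (hT0 : ∀ q πX : Ty, TabOK ((c q).lam0 πX) (getN (getN T0s q.val []) πX.val []))
    (hTP : ∀ q : Ty, List.Forall₂ (fun p T => TabOK p.lam T) (c q).progs (getN TPs q.val []))
    {D : ℤ} {E : E4Lists} (h0 : quarticCheck0 D E = true) (hchk : ∀ q₀ : Ty, quarticCheckAt T0s TPs D E q₀ = true)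
    (P : Ty → ℝ) (hσ : ∑ i, P i = 1) (hP : ∀ i, 0 ≤ P i) (hES : ∀ q : Ty, ES (c q) P ≤ 0) :
    0 ≤ E4cell E P := by
  simp only [quarticCheck0, Bool.and_eq_true, decide_eq_true_iff] at h0
  obtain ⟨hD, hE⟩ := h0
  -- the form of the integer coefficient function vanishes
  have hform : form4 P (fun q r s t => (coefZ4 T0s TPs D E q r s t : ℝ)) = 0 :=
    form4_eq_zero_of_symC4 P _ (symC4_eq_zero_of_checkAt hchk)
  -- and it splits into the `λ₀` part, `σ`·(program part) and `D`·`E₄ʰᵒᵐ`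
  have hsplit : form4 P (fun q r s t => (coefZ4 T0s TPs D E q r s t : ℝ)) =
      (∑ q, P q * ∑ r, ∑ s, ∑ t, ((c q).lam0 r s t : ℝ) * (P r * P s * P t))
      + (∑ r, P r) * (∑ q, P q * ∑ s, ∑ t, (lpC (getN TPs q.val []) s t : ℝ) * (P s * P t))
      + (D : ℝ) * form4 P (fun q r s t => (e4C E q r s t : ℝ)) := by
    have e : (fun q r s t => (coefZ4 T0s TPs D E q r s t : ℝ)) = fun q r s t =>
        (((c q).lam0 r s t : ℝ) + (lpC (getN TPs q.val []) s t : ℝ)) + (D : ℝ) * (e4C E q r s t : ℝ) := by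
      funext q r s t; simp only [coefZ4, hT0 q r s t]; push_cast; ring
    rw [e, form4_add, form4_add, form4_smul, form4_of134, form4_of1]
  rw [hsplit, form4_e4C P hE, hσ] at hform
  simp only [mul_one, one_mul] at hform
  -- the first two parts are `Σ_q P_q · ES (c q) P ≤ 0`
  have hESsum : ∑ q, P q * ES (c q) P ≤ 0 :=
    Finset.sum_nonpos fun q _ => mul_nonpos_of_nonneg_of_nonpos (hP q) (hES q)
  have hES' : ∑ q, P q * ES (c q) P = (∑ q, P q * ∑ r, ∑ s, ∑ t, ((c q).lam0 r s t : ℝ) * (P r * P s * P t))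
      + ∑ q, P q * ∑ s, ∑ t, (lpC (getN TPs q.val []) s t : ℝ) * (P s * P t) := by
    rw [← Finset.sum_add_distrib]
    refine Finset.sum_congr rfl fun q _ => ?_
    rw [ES, esProgs_eq_lpC P (c q).progs (getN TPs q.val []) (hTP q)]; ring
  have hDpos : (0 : ℝ) < D := by exact_mod_cast hD
  have key : (D : ℝ) * E4cell E P = -(∑ q, P q * ES (c q) P) := by
    rw [hES', E4cell]; linarith
  have : 0 ≤ (D : ℝ) * E4cell E P := by rw [key]; linarith
  exact le_of_mul_le_mul_left (by linarith [this]) hDpos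

end SwitchRelax

end Summit.CriticalPhenomena.PercolationContinuityZ3.Theorems
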